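import Mathlib
import HarnessLib
import Summits.QuantumFields.YangMills.Theorems.LangevinControlUVFemtoCurvatureTwoPointMirrorPairCauchySchwarz

/-!
# Crux `FemtoCurvatureTwoPoint` (stmt-QuantumFields-9363, route `LangevinControlUV`):
# reflection-positivity Cauchy–Schwarz for ARBITRARY positive plaquette pairs (part 5)

Helper for the line `generic-step-gamma-encoding` (lead prover, `--supports stmt-QuantumFields-9363`).
Part 3 (`…MirrorPairCauchySchwarz`) treated SPATIAL plaquettes on the time axis; here the same
discriminant inequality `Cov(P_{ϑp}, P_{p'})² ≤ Cov(P_{ϑp}, P_p) · Cov(P_{ϑp'}, P_{p'})` is proved for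
ANY two plaquettes of the positive half — temporal ones included — with the tree's plaquette
reflections `ϑ = WilsonRP.plaqReflect` (link and odd-torus reflections; a temporal plaquette based at
time `t` goes to the temporal plaquette based at `−t`, `Re tr` being insensitive to the reversed
orientation, tree `WilsonRP.plaqRe_timeReflect`) and `ϑ' = WilsonSiteRP.sitePlaqReflect` (site
reflection, tree `WilsonSiteRP.plaqRe_negReflect`): `cov_plaqReflect_sq_le_even` (registered sub-goal
`stub_plaqReflectCauchySchwarz` in closed form), `cov_sitePlaqReflect_sq_le`, `cov_plaqReflect_sq_le_odd`.
This is the input of OFF-AXIS DOMINATION: every plaquette pair separated in some direction `μ` is a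
mirror pair `(ϑq, p')` after a translation, so its covariance is dominated by the geometric mean of two
DIAGONAL (same-family) covariances along `μ` — the reduction of the crux's all-pairs upper clause to
diagonal profiles (sibling line `cosh-mixture-convexity`, `stub_offAxisDomination`).
-/

noncomputable section

open MeasureTheory
open Literature.MathematicalPhysics.QuantumFieldTheory

namespace Summit.QuantumFields.YangMills.Theorems.FemtoCurvatureTwoPoint.AxisCovNonneg

section General

variable {d L N : ℕ} [NeZero d] [NeZero L] {G : Type*} [Group G] [TopologicalSpace G]
  [IsTopologicalGroup G] [CompactSpace G] [MeasurableSpace G] [BorelSpace G]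
  (ρ : G →* Matrix (Fin N) (Fin N) ℂ)

omit [NeZero L] [TopologicalSpace G] [IsTopologicalGroup G] [CompactSpace G] [MeasurableSpace G]
  [BorelSpace G] in
/-- `DependsOn` form of positivity for an arbitrary (possibly temporal) POSITIVE plaquette of the
link reflection: a positive-time observable. [folklore] -/
theorem isPositiveTimeObservable_plaqRe_of_isPosPlaq [Fact (1 < L)] {p : Plaquette d L}
    (hp : WilsonRP.IsPosPlaq p) :
    IsPositiveTimeObservable (fun U : GaugeConfig d L G => WilsonRP.plaqRe ρ U p) := by
  intro U V hUV
  obtain ⟨h1, h2, h3, h4⟩ := WilsonRP.isPosEdge_of_isPosPlaq hp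
  refine dependsOn_plaqRe ρ p fun e he => ?_
  simp only [Set.mem_insert_iff, Set.mem_singleton_iff] at he
  rcases he with rfl | rfl | rfl | rfl
  · exact hUV _ h1.1 h1.2.1 h1.2.2.1 h1.2.2.2
  · exact hUV _ h2.1 h2.2.1 h2.2.2.1 h2.2.2.2
  · exact hUV _ h3.1 h3.2.1 h3.2.2.1 h3.2.2.2
  · exact hUV _ h4.1 h4.2.1 h4.2.2.1 h4.2.2.2

omit [TopologicalSpace G] [IsTopologicalGroup G] [CompactSpace G] [MeasurableSpace G]
  [BorelSpace G] in
/-- An arbitrary site-positive OR shared plaquette depends only on site-positive or shared links.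
[folklore] -/
theorem dependsOn_plaqRe_of_isSitePosPlaq [Fact (1 < L)] (hL : Even L) {p : Plaquette d L}
    (hp : WilsonSiteRP.IsSitePosPlaq p ∨ WilsonSiteRP.IsSharedPlaq p) :
    DependsOn (fun U : GaugeConfig d L G => WilsonRP.plaqRe ρ U p)
      ((WilsonSiteRP.sitePosEdges ∪ WilsonSiteRP.sharedEdges : Finset (Edge d L)) :
        Set (Edge d L)) := by
  intro U V hUV
  obtain ⟨h1, h2, h3, h4⟩ :
      (WilsonSiteRP.IsSitePosEdge (p.1, p.2.1.1) ∨ WilsonSiteRP.IsSharedEdge (p.1, p.2.1.1)) ∧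
      (WilsonSiteRP.IsSitePosEdge (p.1.shift p.2.1.1, p.2.1.2) ∨
        WilsonSiteRP.IsSharedEdge (p.1.shift p.2.1.1, p.2.1.2)) ∧
      (WilsonSiteRP.IsSitePosEdge (p.1.shift p.2.1.2, p.2.1.1) ∨
        WilsonSiteRP.IsSharedEdge (p.1.shift p.2.1.2, p.2.1.1)) ∧
      (WilsonSiteRP.IsSitePosEdge (p.1, p.2.1.2) ∨ WilsonSiteRP.IsSharedEdge (p.1, p.2.1.2)) := by
    rcases hp with hp | hp
    · exact WilsonSiteRP.edges_of_isSitePosPlaq hL hp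
    · obtain ⟨e1, e2, e3, e4⟩ := WilsonSiteRP.edges_of_isSharedPlaq hp
      exact ⟨Or.inr e1, Or.inr e2, Or.inr e3, Or.inr e4⟩
  have hmem : ∀ e : Edge d L, WilsonSiteRP.IsSitePosEdge e ∨ WilsonSiteRP.IsSharedEdge e →
      e ∈ ((WilsonSiteRP.sitePosEdges ∪ WilsonSiteRP.sharedEdges : Finset (Edge d L)) :
        Set (Edge d L)) := fun e he => by
    rw [Finset.coe_union, Set.mem_union, Finset.mem_coe, Finset.mem_coe,
      WilsonSiteRP.mem_sitePosEdges, WilsonSiteRP.mem_sharedEdges]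
    exact he
  refine dependsOn_plaqRe ρ p fun e he => ?_
  simp only [Set.mem_insert_iff, Set.mem_singleton_iff] at he
  rcases he with rfl | rfl | rfl | rfl
  · exact hUV _ (hmem _ h1)
  · exact hUV _ (hmem _ h2)
  · exact hUV _ (hmem _ h3)
  · exact hUV _ (hmem _ h4)

omit [TopologicalSpace G] [IsTopologicalGroup G] [CompactSpace G] [MeasurableSpace G]
  [BorelSpace G] in
/-- An arbitrary odd-positive OR odd-shared plaquette depends only on odd-positive or odd-shared links.
[folklore] -/
theorem dependsOn_plaqRe_of_isOPosPlaq [Fact (1 < L)] (hL : Odd L) {p : Plaquette d L}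
    (hp : WilsonOddRP.IsOPosPlaq p ∨ WilsonOddRP.IsOSharedPlaq p) :
    DependsOn (fun U : GaugeConfig d L G => WilsonRP.plaqRe ρ U p)
      ((WilsonOddRP.oPosEdges ∪ WilsonOddRP.oSharedEdges : Finset (Edge d L)) :
        Set (Edge d L)) := by
  intro U V hUV
  obtain ⟨h1, h2, h3, h4⟩ :
      (WilsonOddRP.IsOPosEdge (p.1, p.2.1.1) ∨ WilsonOddRP.IsOSharedEdge (p.1, p.2.1.1)) ∧
      (WilsonOddRP.IsOPosEdge (p.1.shift p.2.1.1, p.2.1.2) ∨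
        WilsonOddRP.IsOSharedEdge (p.1.shift p.2.1.1, p.2.1.2)) ∧
      (WilsonOddRP.IsOPosEdge (p.1.shift p.2.1.2, p.2.1.1) ∨
        WilsonOddRP.IsOSharedEdge (p.1.shift p.2.1.2, p.2.1.1)) ∧
      (WilsonOddRP.IsOPosEdge (p.1, p.2.1.2) ∨ WilsonOddRP.IsOSharedEdge (p.1, p.2.1.2)) := by
    rcases hp with hp | hp
    · exact WilsonOddRP.edges_of_isOPosPlaq hL hp
    · obtain ⟨e1, e2, e3, e4⟩ := WilsonOddRP.edges_of_isOSharedPlaq hp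
      exact ⟨Or.inr e1, Or.inr e2, Or.inr e3, Or.inr e4⟩
  have hmem : ∀ e : Edge d L, WilsonOddRP.IsOPosEdge e ∨ WilsonOddRP.IsOSharedEdge e →
      e ∈ ((WilsonOddRP.oPosEdges ∪ WilsonOddRP.oSharedEdges : Finset (Edge d L)) :
        Set (Edge d L)) := fun e he => by
    rw [Finset.coe_union, Set.mem_union, Finset.mem_coe, Finset.mem_coe,
      WilsonOddRP.mem_oPosEdges, WilsonOddRP.mem_oSharedEdges]
    exact he
  refine dependsOn_plaqRe ρ p fun e he => ?_
  simp only [Set.mem_insert_iff, Set.mem_singleton_iff] at he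
  rcases he with rfl | rfl | rfl | rfl
  · exact hUV _ (hmem _ h1)
  · exact hUV _ (hmem _ h2)
  · exact hUV _ (hmem _ h3)
  · exact hUV _ (hmem _ h4)

/-- **General reflection-positivity Cauchy–Schwarz, link reflection** (`L` even, `β ≥ 0`): for ANY two
positive plaquettes `p, p'` (spatial or temporal), with `ϑ = WilsonRP.plaqReflect`:
`Cov(P_{ϑp}, P_{p'})² ≤ Cov(P_{ϑp}, P_p) · Cov(P_{ϑp'}, P_{p'})`. [folklore] -/
theorem cov_plaqReflect_sq_le_even (hL : Even L) (hρ : Continuous ρ) {β : ℝ} (hβ : 0 ≤ β)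
    {p p' : Plaquette d L} (hp : WilsonRP.IsPosPlaq p) (hp' : WilsonRP.IsPosPlaq p') :
    (wilsonExpectation ρ β (fun U : GaugeConfig d L G =>
          WilsonRP.plaqRe ρ U (WilsonRP.plaqReflect p) * WilsonRP.plaqRe ρ U p')
        - wilsonExpectation ρ β (fun U : GaugeConfig d L G =>
            WilsonRP.plaqRe ρ U (WilsonRP.plaqReflect p))
          * wilsonExpectation ρ β (fun U : GaugeConfig d L G => WilsonRP.plaqRe ρ U p')) ^ 2 ≤
      (wilsonExpectation ρ β (fun U : GaugeConfig d L G =>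
          WilsonRP.plaqRe ρ U (WilsonRP.plaqReflect p) * WilsonRP.plaqRe ρ U p)
        - wilsonExpectation ρ β (fun U : GaugeConfig d L G =>
            WilsonRP.plaqRe ρ U (WilsonRP.plaqReflect p))
          * wilsonExpectation ρ β (fun U : GaugeConfig d L G => WilsonRP.plaqRe ρ U p)) *
      (wilsonExpectation ρ β (fun U : GaugeConfig d L G =>
          WilsonRP.plaqRe ρ U (WilsonRP.plaqReflect p') * WilsonRP.plaqRe ρ U p')
        - wilsonExpectation ρ β (fun U : GaugeConfig d L G =>
            WilsonRP.plaqRe ρ U (WilsonRP.plaqReflect p'))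
          * wilsonExpectation ρ β (fun U : GaugeConfig d L G => WilsonRP.plaqRe ρ U p')) := by
  haveI := isProbabilityMeasure_wilsonMeasure (d := d) (L := L) ρ hρ β
  haveI : Fact (1 < L) := ⟨by obtain ⟨r, hr⟩ := hL; have := NeZero.ne L; omega⟩
  have key := FiniteSusceptibilityWeakCoupling.RPCauchySchwarz.covariance_rp_cauchySchwarz
    (μ := wilsonMeasure (d := d) (L := L) ρ β) (Θ := GaugeConfig.timeReflect)
    (D := fun H : GaugeConfig d L G → ℝ => IsPositiveTimeObservable H)
    WilsonRP.measurable_timeReflect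
    (FiniteSusceptibilityWeakCoupling.RPCauchySchwarz.wilsonMeasure_map_timeReflect ρ hρ β)
    FiniteSusceptibilityWeakCoupling.RPCauchySchwarz.timeReflect_timeReflect
    (fun H hH hHb hHD => integral_timeReflect_mul_nonneg_even ρ hL hρ hβ H hH hHb hHD)
    (fun H K t hH hK => isPositiveTimeObservable_add_mul hH hK t)
    (fun H c hH => isPositiveTimeObservable_sub_const hH c)
    (WilsonRP.measurable_plaqRe ρ hρ p) (WilsonRP.measurable_plaqRe ρ hρ p')
    ⟨N, fun U => WilsonRP.abs_plaqRe_le ρ hρ U p⟩ ⟨N, fun U => WilsonRP.abs_plaqRe_le ρ hρ U p'⟩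
    (isPositiveTimeObservable_plaqRe_of_isPosPlaq ρ hp)
    (isPositiveTimeObservable_plaqRe_of_isPosPlaq ρ hp')
  obtain ⟨-, -, hcs⟩ := key
  rw [covariance_plaqRe_eq ρ hρ β p p' _ WilsonRP.measurable_timeReflect,
    covariance_plaqRe_eq ρ hρ β p p _ WilsonRP.measurable_timeReflect,
    covariance_plaqRe_eq ρ hρ β p' p' _ WilsonRP.measurable_timeReflect] at hcs
  simpa only [WilsonRP.plaqRe_timeReflect ρ hρ] using hcs

/-- **General reflection-positivity Cauchy–Schwarz, site reflection** (`L` even, any `β`): for ANY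
two site-positive or shared plaquettes (shared = spatial inside a reflection hyperplane, fixed by `ϑ'`),
with `ϑ' = WilsonSiteRP.sitePlaqReflect`. [folklore] -/
theorem cov_sitePlaqReflect_sq_le (hL : Even L) (hρ : Continuous ρ) (β : ℝ)
    {p p' : Plaquette d L} (hp : WilsonSiteRP.IsSitePosPlaq p ∨ WilsonSiteRP.IsSharedPlaq p)
    (hp' : WilsonSiteRP.IsSitePosPlaq p' ∨ WilsonSiteRP.IsSharedPlaq p') :
    (wilsonExpectation ρ β (fun U : GaugeConfig d L G =>
          WilsonRP.plaqRe ρ U (WilsonSiteRP.sitePlaqReflect p) * WilsonRP.plaqRe ρ U p')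
        - wilsonExpectation ρ β (fun U : GaugeConfig d L G =>
            WilsonRP.plaqRe ρ U (WilsonSiteRP.sitePlaqReflect p))
          * wilsonExpectation ρ β (fun U : GaugeConfig d L G => WilsonRP.plaqRe ρ U p')) ^ 2 ≤
      (wilsonExpectation ρ β (fun U : GaugeConfig d L G =>
          WilsonRP.plaqRe ρ U (WilsonSiteRP.sitePlaqReflect p) * WilsonRP.plaqRe ρ U p)
        - wilsonExpectation ρ β (fun U : GaugeConfig d L G =>
            WilsonRP.plaqRe ρ U (WilsonSiteRP.sitePlaqReflect p))
          * wilsonExpectation ρ β (fun U : GaugeConfig d L G => WilsonRP.plaqRe ρ U p)) *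
      (wilsonExpectation ρ β (fun U : GaugeConfig d L G =>
          WilsonRP.plaqRe ρ U (WilsonSiteRP.sitePlaqReflect p') * WilsonRP.plaqRe ρ U p')
        - wilsonExpectation ρ β (fun U : GaugeConfig d L G =>
            WilsonRP.plaqRe ρ U (WilsonSiteRP.sitePlaqReflect p'))
          * wilsonExpectation ρ β (fun U : GaugeConfig d L G => WilsonRP.plaqRe ρ U p')) := by
  haveI := isProbabilityMeasure_wilsonMeasure (d := d) (L := L) ρ hρ β
  haveI : Fact (1 < L) := ⟨by obtain ⟨r, hr⟩ := hL; have := NeZero.ne L; omega⟩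
  have key := FiniteSusceptibilityWeakCoupling.RPCauchySchwarz.covariance_rp_cauchySchwarz
    (μ := wilsonMeasure (d := d) (L := L) ρ β) (Θ := GaugeConfig.negReflect)
    (D := fun H : GaugeConfig d L G → ℝ => DependsOn H
      ((WilsonSiteRP.sitePosEdges ∪ WilsonSiteRP.sharedEdges : Finset (Edge d L)) : Set (Edge d L)))
    WilsonSiteRP.measurable_negReflect (WilsonSiteRP.wilsonMeasure_map_negReflect ρ hL hρ β)
    WilsonSiteRP.negReflect_negReflect_config
    (fun H hH hHb hHD => integral_negReflect_mul_nonneg ρ hL hρ β H hH hHb hHD)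
    (fun H K t hH hK => FiniteSusceptibilityWeakCoupling.RPCauchySchwarz.dependsOn_add_mul hH hK t)
    (fun H c hH => FiniteSusceptibilityWeakCoupling.RPCauchySchwarz.dependsOn_sub_const hH c)
    (WilsonRP.measurable_plaqRe ρ hρ p) (WilsonRP.measurable_plaqRe ρ hρ p')
    ⟨N, fun U => WilsonRP.abs_plaqRe_le ρ hρ U p⟩ ⟨N, fun U => WilsonRP.abs_plaqRe_le ρ hρ U p'⟩
    (dependsOn_plaqRe_of_isSitePosPlaq ρ hL hp) (dependsOn_plaqRe_of_isSitePosPlaq ρ hL hp')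
  obtain ⟨-, -, hcs⟩ := key
  rw [covariance_plaqRe_eq ρ hρ β p p' _ WilsonSiteRP.measurable_negReflect,
    covariance_plaqRe_eq ρ hρ β p p _ WilsonSiteRP.measurable_negReflect,
    covariance_plaqRe_eq ρ hρ β p' p' _ WilsonSiteRP.measurable_negReflect] at hcs
  simpa only [WilsonSiteRP.plaqRe_negReflect ρ hρ] using hcs

/-- **General reflection-positivity Cauchy–Schwarz, odd torus** (`L` odd, `L ≥ 3`, `β ≥ 0`): for ANY
two odd-positive or odd-shared plaquettes (odd-shared = spatial at `t = L/2 + 1`, fixed by `ϑ`), with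
`ϑ = WilsonRP.plaqReflect`. [folklore] -/
theorem cov_plaqReflect_sq_le_odd (hL : Odd L) (hL3 : 3 ≤ L) (hρ : Continuous ρ) {β : ℝ}
    (hβ : 0 ≤ β) {p p' : Plaquette d L} (hp : WilsonOddRP.IsOPosPlaq p ∨ WilsonOddRP.IsOSharedPlaq p)
    (hp' : WilsonOddRP.IsOPosPlaq p' ∨ WilsonOddRP.IsOSharedPlaq p') :
    (wilsonExpectation ρ β (fun U : GaugeConfig d L G =>
          WilsonRP.plaqRe ρ U (WilsonRP.plaqReflect p) * WilsonRP.plaqRe ρ U p')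
        - wilsonExpectation ρ β (fun U : GaugeConfig d L G =>
            WilsonRP.plaqRe ρ U (WilsonRP.plaqReflect p))
          * wilsonExpectation ρ β (fun U : GaugeConfig d L G => WilsonRP.plaqRe ρ U p')) ^ 2 ≤
      (wilsonExpectation ρ β (fun U : GaugeConfig d L G =>
          WilsonRP.plaqRe ρ U (WilsonRP.plaqReflect p) * WilsonRP.plaqRe ρ U p)
        - wilsonExpectation ρ β (fun U : GaugeConfig d L G =>
            WilsonRP.plaqRe ρ U (WilsonRP.plaqReflect p))
          * wilsonExpectation ρ β (fun U : GaugeConfig d L G => WilsonRP.plaqRe ρ U p)) *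
      (wilsonExpectation ρ β (fun U : GaugeConfig d L G =>
          WilsonRP.plaqRe ρ U (WilsonRP.plaqReflect p') * WilsonRP.plaqRe ρ U p')
        - wilsonExpectation ρ β (fun U : GaugeConfig d L G =>
            WilsonRP.plaqRe ρ U (WilsonRP.plaqReflect p'))
          * wilsonExpectation ρ β (fun U : GaugeConfig d L G => WilsonRP.plaqRe ρ U p')) := by
  haveI := isProbabilityMeasure_wilsonMeasure (d := d) (L := L) ρ hρ β
  haveI : Fact (1 < L) := ⟨by omega⟩
  have key := FiniteSusceptibilityWeakCoupling.RPCauchySchwarz.covariance_rp_cauchySchwarz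
    (μ := wilsonMeasure (d := d) (L := L) ρ β) (Θ := GaugeConfig.timeReflect)
    (D := fun H : GaugeConfig d L G → ℝ => DependsOn H
      ((WilsonOddRP.oPosEdges ∪ WilsonOddRP.oSharedEdges : Finset (Edge d L)) : Set (Edge d L)))
    WilsonRP.measurable_timeReflect
    (FiniteSusceptibilityWeakCoupling.RPCauchySchwarz.wilsonMeasure_map_timeReflect ρ hρ β)
    FiniteSusceptibilityWeakCoupling.RPCauchySchwarz.timeReflect_timeReflect
    (fun H hH hHb hHD => integral_timeReflect_mul_nonneg_odd ρ hL hL3 hρ hβ H hH hHb hHD)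
    (fun H K t hH hK => FiniteSusceptibilityWeakCoupling.RPCauchySchwarz.dependsOn_add_mul hH hK t)
    (fun H c hH => FiniteSusceptibilityWeakCoupling.RPCauchySchwarz.dependsOn_sub_const hH c)
    (WilsonRP.measurable_plaqRe ρ hρ p) (WilsonRP.measurable_plaqRe ρ hρ p')
    ⟨N, fun U => WilsonRP.abs_plaqRe_le ρ hρ U p⟩ ⟨N, fun U => WilsonRP.abs_plaqRe_le ρ hρ U p'⟩
    (dependsOn_plaqRe_of_isOPosPlaq ρ hL hp) (dependsOn_plaqRe_of_isOPosPlaq ρ hL hp')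
  obtain ⟨-, -, hcs⟩ := key
  rw [covariance_plaqRe_eq ρ hρ β p p' _ WilsonRP.measurable_timeReflect,
    covariance_plaqRe_eq ρ hρ β p p _ WilsonRP.measurable_timeReflect,
    covariance_plaqRe_eq ρ hρ β p' p' _ WilsonRP.measurable_timeReflect] at hcs
  simpa only [WilsonRP.plaqRe_timeReflect ρ hρ] using hcs

end General

end Summit.QuantumFields.YangMills.Theorems.FemtoCurvatureTwoPoint.AxisCovNonneg

namespace Summit.QuantumFields.YangMills.Theorems.FemtoCurvatureTwoPoint

/-- **Registered sub-goal `stub_plaqReflectCauchySchwarz`** (`--supports stmt-QuantumFields-9363`):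
reflection-positivity Cauchy–Schwarz for arbitrary (spatial or temporal) positive plaquette pairs under
the link reflection on even tori at `β ≥ 0` (closed form of `AxisCovNonneg.cov_plaqReflect_sq_le_even`,
fully qualified). [folklore] -/
theorem stub_plaqReflectCauchySchwarz : ∀ (d L N : ℕ) [NeZero d] [NeZero L] (G : Type) [Group G] [TopologicalSpace G] [IsTopologicalGroup G] [CompactSpace G] [MeasurableSpace G] [BorelSpace G] (ρ : G →* Matrix (Fin N) (Fin N) ℂ), Continuous ρ → Even L → ∀ (β : ℝ), 0 ≤ β → ∀ (p p' : Literature.MathematicalPhysics.QuantumFieldTheory.Plaquette d L), Literature.MathematicalPhysics.QuantumFieldTheory.WilsonRP.IsPosPlaq p → Literature.MathematicalPhysics.QuantumFieldTheory.WilsonRP.IsPosPlaq p' → (Literature.MathematicalPhysics.QuantumFieldTheory.wilsonExpectation ρ β (fun U : Literature.MathematicalPhysics.QuantumFieldTheory.GaugeConfig d L G => Literature.MathematicalPhysics.QuantumFieldTheory.WilsonRP.plaqRe ρ U (Literature.MathematicalPhysics.QuantumFieldTheory.WilsonRP.plaqReflect p) * Literature.MathematicalPhysics.QuantumFieldTheory.WilsonRP.plaqRe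 ρ U p') - Literature.MathematicalPhysics.QuantumFieldTheory.wilsonExpectation ρ β (fun U : Literature.MathematicalPhysics.QuantumFieldTheory.GaugeConfig d L G => Literature.MathematicalPhysics.QuantumFieldTheory.WilsonRP.plaqRe ρ U (Literature.MathematicalPhysics.QuantumFieldTheory.WilsonRP.plaqReflect p)) * Literature.MathematicalPhysics.QuantumFieldTheory.wilsonExpectation ρ β (fun U : Literature.MathematicalPhysics.QuantumFieldTheory.GaugeConfig d L G => Literature.MathematicalPhysics.QuantumFieldTheory.WilsonRP.plaqRe ρ U p')) ^ 2 ≤ (Literature.MathematicalPhysics.QuantumFieldTheory.wilsonExpectation ρ β (fun U : Literature.MathematicalPhysics.QuantumFieldTheory.GaugeConfig d L G => Literature.MathematicalPhysics.QuantumFieldTheory.WilsonRP.plaqRe ρ U (Literature.MathematicalPhysics.QuantumFieldTheory.WilsonRP.plaqReflect p) * Literature.MathematicalPhysics.QuantumFieldTheory.WilsonRP.plaqRe ρ U p) - Literature.MathematicalPhysics.QuantumFieldTheory.wilsonExpectation ρ β (fun U : Literature.MathematicalPhysics.QuantumFieldTheory.GaugeConfig d L G => Literature.MathematicalPhysics.QuantumFieldTheory.WilsonRP.plaqRe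 ρ U (Literature.MathematicalPhysics.QuantumFieldTheory.WilsonRP.plaqReflect p)) * Literature.MathematicalPhysics.QuantumFieldTheory.wilsonExpectation ρ β (fun U : Literature.MathematicalPhysics.QuantumFieldTheory.GaugeConfig d L G => Literature.MathematicalPhysics.QuantumFieldTheory.WilsonRP.plaqRe ρ U p)) * (Literature.MathematicalPhysics.QuantumFieldTheory.wilsonExpectation ρ β (fun U : Literature.MathematicalPhysics.QuantumFieldTheory.GaugeConfig d L G => Literature.MathematicalPhysics.QuantumFieldTheory.WilsonRP.plaqRe ρ U (Literature.MathematicalPhysics.QuantumFieldTheory.WilsonRP.plaqReflect p') * Literature.MathematicalPhysics.QuantumFieldTheory.WilsonRP.plaqRe ρ U p') - Literature.MathematicalPhysics.QuantumFieldTheory.wilsonExpectation ρ β (fun U : Literature.MathematicalPhysics.QuantumFieldTheory.GaugeConfig d L G => Literature.MathematicalPhysics.QuantumFieldTheory.WilsonRP.plaqRe ρ U (Literature.MathematicalPhysics.QuantumFieldTheory.WilsonRP.plaqReflect p')) * Literature.MathematicalPhysics.QuantumFieldTheory.wilsonExpectation ρ β (fun U : Literature.MathematicalPhysics.QuantumFieldTheory.GaugeConfig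 d L G => Literature.MathematicalPhysics.QuantumFieldTheory.WilsonRP.plaqRe ρ U p')) := by
  intro d L N _ _ G _ _ _ _ _ _ ρ hρ hL β hβ p p' hp hp'
  exact AxisCovNonneg.cov_plaqReflect_sq_le_even ρ hL hρ hβ hp hp'

end Summit.QuantumFields.YangMills.Theorems.FemtoCurvatureTwoPoint

end
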